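import Literature.Probability.Independence.HoeffdingDecomposition
import HarnessLib

/-!
# Hoeffding's (Efron–Stein, ANOVA) decomposition on a finite product of a probability space — the parts

Continuation of `HoeffdingDecomposition.lean` (averaging operators `E_A = condAvg μ A`).  Sources: W. Hoeffding, Ann. Math.
Statist. 19 (1948), §5; B. Efron, C. Stein, Ann. Statist. 9 (1981), §2 (ANOVA decomposition `S = Σ_{A⊆[n]} S_A` of a
statistic of independent variables, `S_A` depending on `(X_i)_{i∈A}` only, with `E(S_A | X_B) = 0` unless `A ⊆ B`; uniqueness).
Measure-theoretic twin (product `ι → β` of ONE probability space `(β, μ)`, bounded measurable real `f`) of the tree's finite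
uniform-measure module `Literature/Combinatorics/Additive/ProductSpaceOperators.lean` (same names):
* `esPart μ T f = f^{=T} := Σ_{R⊆T} (-1)^{|T|+|R|} E_{Rᶜ} f`; `dependsOff_esPart`, `measurable_esPart`, `abs_esPart_le` (`≤ 2^{|T|} C`);
* `sum_esPart` — **Hoeffding's decomposition `Σ_T f^{=T} = f`** (pointwise, hypothesis-free Möbius inversion);
* `condAvg_esPart_comm`, `condAvg_esPart_eq_zero` (`E_A` kills the parts it meets), `condAvg_esPart_of_disjoint`, `esPart_condAvg`,
  `esPart_esPart` (`(f^{=T})^{=T'} = [T = T'] f^{=T}`);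
* `ae_eq_zero_of_sum_parts` — **uniqueness, a.e. form**: bounded measurable `h_T` depending only on `x_T`, with a.e.-vanishing
  conditional mean in every coordinate of `T`, and `Σ_T h_T = 0` a.e., are all a.e. zero (operator
  `Π_{i∈T₀}(1 − E_i) ∘ E_{T₀ᶜ}` isolates `h_{T₀}`).
No instances, no notation; standard axioms.  WHAT THIS IS NOT: no `L²` orthogonality, no variance (Efron–Stein) inequality.
-/

set_option autoImplicit false

noncomputable section

open MeasureTheory Finset Function

namespace Literature.Probability.Independence.Hoeffding

variable {ι : Type*} [Fintype ι] [DecidableEq ι] {β : Type*} [MeasurableSpace β]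
variable {μ : Measure β}

/-! ## Two combinatorial identities on the Boolean lattice -/
omit [Fintype ι] [MeasurableSpace β] in
/-- Pairing lemma: an alternating sum over `T.powerset` vanishes when the summand is invariant under inserting some fixed
`i ∈ T`. [cite: EfronStein1981, §2] -/
private theorem sum_powerset_neg_one_pow_mul_eq_zero {T : Finset ι} {i : ι} (hi : i ∈ T) (Φ : Finset ι → ℝ)
    (hΦ : ∀ R, R ⊆ T.erase i → Φ (insert i R) = Φ R) :
    ∑ R ∈ T.powerset, (-1 : ℝ) ^ R.card * Φ R = 0 := by
  have hT : T = insert i (T.erase i) := (Finset.insert_erase hi).symm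
  rw [hT, Finset.sum_powerset_insert (Finset.notMem_erase i T), ← Finset.sum_add_distrib]
  refine Finset.sum_eq_zero fun R hR => ?_
  rw [Finset.mem_powerset] at hR
  have hiR : i ∉ R := fun h => Finset.notMem_erase i T (hR h)
  rw [Finset.card_insert_of_notMem hiR, pow_succ, hΦ R hR]
  ring
omit [Fintype ι] [MeasurableSpace β] in
/-- Möbius identity `∑_{U ⊆ S} (-1)^{|U|} = [S = ∅]`. [cite: EfronStein1981, §2] -/
private theorem sum_powerset_neg_one_pow_card_real (S : Finset ι) :
    ∑ U ∈ S.powerset, (-1 : ℝ) ^ U.card = if S = ∅ then 1 else 0 := by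
  split_ifs with hS
  · subst hS
    simp
  · exact_mod_cast Finset.sum_powerset_neg_one_pow_card_of_nonempty (Finset.nonempty_iff_ne_empty.2 hS)
omit [Fintype ι] [MeasurableSpace β] in
/-- Exchange of a double sum over `{(T, R) : R ⊆ T}`. [cite: EfronStein1981, §2] -/
private theorem sum_sum_powerset_comm [Fintype ι] {M : Type*} [AddCommMonoid M] (a : Finset ι → Finset ι → M) :
    ∑ T : Finset ι, ∑ R ∈ T.powerset, a T R = ∑ R : Finset ι, ∑ U ∈ (univ \ R).powerset, a (R ∪ U) R := by
  have hL : ∑ T : Finset ι, ∑ R ∈ T.powerset, a T R = ∑ T : Finset ι, ∑ R : Finset ι, if R ⊆ T then a T R else 0 := by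
    refine Finset.sum_congr rfl fun T _ => ?_
    rw [← Finset.sum_filter]
    congr 1
    ext R
    simp
  have hR : ∑ R : Finset ι, ∑ U ∈ (univ \ R).powerset, a (R ∪ U) R =
      ∑ R : Finset ι, ∑ T : Finset ι, if R ⊆ T then a T R else 0 := by
    refine Finset.sum_congr rfl fun R _ => ?_
    rw [← Finset.sum_filter]
    refine Finset.sum_nbij' (fun U => R ∪ U) (fun T => T \ R) ?_ ?_ ?_ ?_ ?_
    · intro U _
      simp only [Finset.mem_filter, Finset.mem_univ, true_and]
      exact Finset.subset_union_left
    · intro T _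
      simp only [Finset.mem_powerset]
      exact Finset.sdiff_subset_sdiff (Finset.subset_univ _) le_rfl
    · intro U hU
      rw [Finset.mem_powerset] at hU
      rw [Finset.union_sdiff_left]
      ext j
      simp only [Finset.mem_sdiff]
      constructor
      · exact fun h => h.1
      · intro hj
        exact ⟨hj, fun hjR => by
          have := hU hj
          rw [Finset.mem_sdiff] at this
          exact this.2 hjR⟩
    · intro T hT
      simp only [Finset.mem_filter, Finset.mem_univ, true_and] at hT
      exact Finset.union_sdiff_of_subset hT
    · intro U _
      rfl
  rw [hL, hR, Finset.sum_comm]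

/-! ## Efron–Stein (Hoeffding) parts -/

variable (μ) in
/-- **The Hoeffding / Efron–Stein part** `f^{=T} := ∑_{R ⊆ T} (-1)^{|T|+|R|} E_{Rᶜ} f` (inclusion–exclusion form): the
component of `f` that depends exactly on the coordinates in `T`. [cite: EfronStein1981, §2 (ANOVA decomposition `S = Σ_A S_A`)]
[cite: Hoeffding1948, §5] -/
def esPart (T : Finset ι) (f : (ι → β) → ℝ) (x : ι → β) : ℝ :=
  ∑ R ∈ T.powerset, (-1 : ℝ) ^ (T.card + R.card) * condAvg μ (univ \ R) f x
/-- `f^{=T}` does not depend on the coordinates outside `T`. [cite: EfronStein1981, §2] -/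
theorem dependsOff_esPart (T : Finset ι) (f : (ι → β) → ℝ) : DependsOff (univ \ T) (esPart μ T f) := by
  intro x x' h
  unfold esPart
  refine Finset.sum_congr rfl fun R hR => ?_
  rw [Finset.mem_powerset] at hR
  congr 1
  exact dependsOff_condAvg (μ := μ) (univ \ R) f x x' fun i hi => h i fun hi' => hi (by
    rw [Finset.mem_sdiff] at hi' ⊢
    exact ⟨hi'.1, fun hR' => hi'.2 (hR hR')⟩)
/-- `f^{=T}` is measurable. [cite: EfronStein1981, §2] -/
theorem measurable_esPart [SigmaFinite μ] (T : Finset ι) {f : (ι → β) → ℝ} (hf : Measurable f) :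
    Measurable (esPart μ T f) := by
  unfold esPart
  refine Finset.measurable_sum _ fun R _ => ?_
  exact (measurable_condAvg (univ \ R) hf).const_mul _
/-- `|f| ≤ C` implies `|f^{=T}| ≤ 2^{|T|} C`. [cite: EfronStein1981, §2] -/
theorem abs_esPart_le [IsProbabilityMeasure μ] (T : Finset ι) {f : (ι → β) → ℝ} {C : ℝ} (hC : ∀ x, |f x| ≤ C)
    (x : ι → β) : |esPart μ T f x| ≤ 2 ^ T.card * C := by
  unfold esPart
  calc |∑ R ∈ T.powerset, (-1 : ℝ) ^ (T.card + R.card) * condAvg μ (univ \ R) f x|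
      ≤ ∑ R ∈ T.powerset, |(-1 : ℝ) ^ (T.card + R.card) * condAvg μ (univ \ R) f x| := Finset.abs_sum_le_sum_abs _ _
    _ ≤ ∑ R ∈ T.powerset, C := Finset.sum_le_sum fun R _ => by
        rw [abs_mul, abs_pow, abs_neg, abs_one, one_pow, one_mul]
        exact abs_condAvg_le hC x
    _ = 2 ^ T.card * C := by rw [Finset.sum_const, Finset.card_powerset, nsmul_eq_mul]; push_cast; ring
/-- **Hoeffding's decomposition** `∑_T f^{=T} = f` (pointwise, no hypothesis on `f`: Möbius inversion on the Boolean
lattice). [cite: Hoeffding1948, §5] [cite: EfronStein1981, §2 (`S = Σ_A S_A`)] -/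
theorem sum_esPart (f : (ι → β) → ℝ) (x : ι → β) : ∑ T : Finset ι, esPart μ T f x = f x := by
  unfold esPart
  rw [sum_sum_powerset_comm (fun T R => (-1 : ℝ) ^ (T.card + R.card) * condAvg μ (univ \ R) f x)]
  have inner : ∀ R : Finset ι, ∑ U ∈ (univ \ R).powerset,
      (-1 : ℝ) ^ ((R ∪ U).card + R.card) * condAvg μ (univ \ R) f x =
        (if univ \ R = ∅ then 1 else 0) * condAvg μ (univ \ R) f x := by
    intro R
    rw [← Finset.sum_mul, ← sum_powerset_neg_one_pow_card_real]
    congr 1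
    refine Finset.sum_congr rfl fun U hU => ?_
    rw [Finset.mem_powerset] at hU
    have hdisj : Disjoint R U := by
      rw [Finset.disjoint_left]
      intro j hjR hjU
      have := hU hjU
      rw [Finset.mem_sdiff] at this
      exact this.2 hjR
    rw [Finset.card_union_of_disjoint hdisj, show R.card + U.card + R.card = U.card + 2 * R.card by ring,
      pow_add, pow_mul]
    norm_num
  simp_rw [inner]
  simp_rw [Finset.sdiff_eq_empty_iff_subset, Finset.univ_subset_iff, ite_mul, one_mul, zero_mul]
  rw [Finset.sum_ite_eq' univ (univ : Finset ι)]
  simp only [Finset.mem_univ, if_true, Finset.sdiff_self]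
  rw [show (∅ : Finset ι) = ∅ from rfl, condAvg_empty]

section Prob

variable [IsProbabilityMeasure μ] {f : (ι → β) → ℝ}
/-- `E_A f^{=T} = (E_A f)^{=T}` (the averaging operators commute; bounded measurable `f`). [cite: EfronStein1981, §2] -/
theorem condAvg_esPart_comm (A T : Finset ι) (hf : Measurable f) {C : ℝ} (hC : ∀ x, |f x| ≤ C) :
    condAvg μ A (esPart μ T f) = esPart μ T (condAvg μ A f) := by
  funext x
  unfold esPart
  rw [show (fun x => ∑ R ∈ T.powerset, (-1 : ℝ) ^ (T.card + R.card) * condAvg μ (univ \ R) f x) =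
      fun x => ∑ R ∈ T.powerset, (fun x => (-1 : ℝ) ^ (T.card + R.card) * condAvg μ (univ \ R) f x) x
    from rfl, condAvg_finset_sum]
  · refine Finset.sum_congr rfl fun R _ => ?_
    rw [condAvg_smul]
    simp only
    rw [condAvg_comm _ _ hf hC]
  · intro R _
    exact (measurable_condAvg _ hf).const_mul _
  · intro R _
    exact ⟨C, fun y => by
      rw [abs_mul, abs_pow, abs_neg, abs_one, one_pow, one_mul]
      exact abs_condAvg_le hC y⟩
/-- **`E_A` kills the parts it meets**: `i ∈ A ∩ T` ⇒ `E_A f^{=T} = 0` (the part `f^{=T}` has conditional mean zero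
in each of its coordinates). [cite: EfronStein1981, §2 (`E(S_A | X_j, j ∈ B) = 0` unless `A ⊆ B`)] -/
theorem condAvg_esPart_eq_zero {A T : Finset ι} {i : ι} (hiA : i ∈ A) (hiT : i ∈ T) (hf : Measurable f) {C : ℝ}
    (hC : ∀ x, |f x| ≤ C) : condAvg μ A (esPart μ T f) = fun _ => 0 := by
  funext x
  rw [condAvg_esPart_comm A T hf hC]
  unfold esPart
  simp_rw [condAvg_condAvg _ _ hf hC]
  have key := sum_powerset_neg_one_pow_mul_eq_zero hiT (fun R => condAvg μ (univ \ R ∪ A) f x) ?_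
  · calc ∑ R ∈ T.powerset, (-1 : ℝ) ^ (T.card + R.card) * condAvg μ (univ \ R ∪ A) f x
        = (-1 : ℝ) ^ T.card * ∑ R ∈ T.powerset, (-1 : ℝ) ^ R.card * condAvg μ (univ \ R ∪ A) f x := by
          rw [Finset.mul_sum]
          exact Finset.sum_congr rfl fun R _ => by rw [pow_add]; ring
      _ = 0 := by rw [key, mul_zero]
  · intro R _
    congr 1
    ext j
    simp only [Finset.mem_union, Finset.mem_sdiff, Finset.mem_univ, true_and, Finset.mem_insert, not_or]
    constructor
    · rintro (⟨-, hjR⟩ | hjA)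
      · exact Or.inl hjR
      · exact Or.inr hjA
    · rintro (hjR | hjA)
      · by_cases hji : j = i
        · exact Or.inr (hji ▸ hiA)
        · exact Or.inl ⟨hji, hjR⟩
      · exact Or.inr hjA
/-- **`E_A` fixes the parts it misses**: `A ∩ T = ∅` ⇒ `E_A f^{=T} = f^{=T}`. [cite: EfronStein1981, §2] -/
theorem condAvg_esPart_of_disjoint {A T : Finset ι} (h : Disjoint A T) (f : (ι → β) → ℝ) :
    condAvg μ A (esPart μ T f) = esPart μ T f :=
  ((dependsOff_esPart T f).mono (by
    intro i hi
    rw [Finset.mem_sdiff]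
    exact ⟨Finset.mem_univ _, fun hiT => Finset.disjoint_left.1 h hi hiT⟩)).condAvg_eq

/-- `(E_A f)^{=T} = [A ∩ T = ∅] · f^{=T}`. [cite: EfronStein1981, §2] -/
theorem esPart_condAvg (A T : Finset ι) (hf : Measurable f) {C : ℝ} (hC : ∀ x, |f x| ≤ C) :
    esPart μ T (condAvg μ A f) = if Disjoint A T then esPart μ T f else fun _ => 0 := by
  rw [← condAvg_esPart_comm A T hf hC]
  split_ifs with h
  · exact condAvg_esPart_of_disjoint h f
  · obtain ⟨i, hiA, hiT⟩ : ∃ i, i ∈ A ∧ i ∈ T := by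
      rw [Finset.not_disjoint_iff] at h
      exact h
    exact condAvg_esPart_eq_zero hiA hiT hf hC

/-- **The parts of a part**: `(f^{=T})^{=T'} = [T = T'] f^{=T}` (uniqueness of the decomposition into parts).
[cite: EfronStein1981, §2] -/
theorem esPart_esPart (T T' : Finset ι) (hf : Measurable f) {C : ℝ} (hC : ∀ x, |f x| ≤ C) :
    esPart μ T' (esPart μ T f) = if T = T' then esPart μ T f else fun _ => 0 := by
  have hm : Measurable (esPart μ T f) := measurable_esPart T hf
  have hb : ∀ x, |esPart μ T f x| ≤ 2 ^ T.card * C := abs_esPart_le T hC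
  by_cases hTT : T = T'
  · subst hTT
    rw [if_pos rfl]
    -- `(f^{=T})^{=T} = Σ_{R ⊆ T} (-1)^{|T|+|R|} E_{Rᶜ} f^{=T}`, and `E_{Rᶜ} f^{=T} = [R = T] f^{=T}` … only `R = T` survives
    funext x
    unfold esPart
    rw [← Finset.sum_erase_add _ _ (Finset.mem_powerset_self T)]
    have hzero : ∑ R ∈ T.powerset.erase T, (-1 : ℝ) ^ (T.card + R.card) *
        condAvg μ (univ \ R) (fun x => ∑ R' ∈ T.powerset, (-1 : ℝ) ^ (T.card + R'.card) * condAvg μ (univ \ R') f x) x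
        = 0 := by
      refine Finset.sum_eq_zero fun R hR => ?_
      rw [Finset.mem_erase, Finset.mem_powerset] at hR
      obtain ⟨i, hiT, hiR⟩ : ∃ i, i ∈ T ∧ i ∉ R := Finset.exists_of_ssubset (lt_of_le_of_ne hR.2 hR.1)
      have := condAvg_esPart_eq_zero (μ := μ) (A := univ \ R) (T := T) (i := i)
        (Finset.mem_sdiff.2 ⟨Finset.mem_univ _, hiR⟩) hiT hf hC
      unfold esPart at this
      rw [this, mul_zero]
    rw [hzero, zero_add]
    have hfix := condAvg_esPart_of_disjoint (μ := μ) (A := univ \ T) (T := T) Finset.sdiff_disjoint f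
    unfold esPart at hfix
    rw [hfix, ← two_mul, pow_mul]
    norm_num
  · rw [if_neg hTT]
    funext x
    -- some coordinate distinguishes `T` from `T'`
    by_cases hsub : T' ⊆ T
    · -- then `T ⊄ T'`: pick `i ∈ T \ T'`; every `E_{Rᶜ}` with `R ⊆ T'` contains `i` and kills `f^{=T}`
      obtain ⟨i, hiT, hiT'⟩ : ∃ i, i ∈ T ∧ i ∉ T' :=
        Finset.exists_of_ssubset (lt_of_le_of_ne hsub (Ne.symm hTT))
      unfold esPart
      refine Finset.sum_eq_zero fun R hR => ?_
      rw [Finset.mem_powerset] at hR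
      have := condAvg_esPart_eq_zero (μ := μ) (A := univ \ R) (T := T) (i := i)
        (Finset.mem_sdiff.2 ⟨Finset.mem_univ _, fun h => hiT' (hR h)⟩) hiT hf hC
      unfold esPart at this
      rw [this, mul_zero]
    · -- `T' ⊄ T`: pick `i ∈ T' \ T`; `f^{=T}` does not depend on `i`, so the pairing lemma kills the alternating sum
      obtain ⟨i, hiT', hiT⟩ : ∃ i, i ∈ T' ∧ i ∉ T := Finset.not_subset.1 hsub
      unfold esPart
      have key := sum_powerset_neg_one_pow_mul_eq_zero hiT' (fun R => condAvg μ (univ \ R) (esPart μ T f) x) ?_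
      · unfold esPart at key
        calc ∑ R ∈ T'.powerset, (-1 : ℝ) ^ (T'.card + R.card) *
              condAvg μ (univ \ R) (fun x => ∑ R' ∈ T.powerset, (-1 : ℝ) ^ (T.card + R'.card) *
                condAvg μ (univ \ R') f x) x
            = (-1 : ℝ) ^ T'.card * ∑ R ∈ T'.powerset, (-1 : ℝ) ^ R.card *
              condAvg μ (univ \ R) (fun x => ∑ R' ∈ T.powerset, (-1 : ℝ) ^ (T.card + R'.card) *
                condAvg μ (univ \ R') f x) x := by
              rw [Finset.mul_sum]
              exact Finset.sum_congr rfl fun R _ => by rw [pow_add]; ring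
          _ = 0 := by rw [key, mul_zero]
      · intro R hR
        -- `E_{(insert i R)ᶜ} g = E_{Rᶜ} g` for `g = f^{=T}` not depending on `i`: drop `i` from `Rᶜ`
        have hdep : DependsOff {i} (esPart μ T f) :=
          (dependsOff_esPart T f).mono (Finset.singleton_subset_iff.2 (Finset.mem_sdiff.2 ⟨Finset.mem_univ _, hiT⟩))
        rw [condAvg_eq_condAvg_sdiff (A := univ \ R) hdep hm hb]
        congr 1
        ext j
        simp only [Finset.mem_sdiff, Finset.mem_univ, true_and, Finset.mem_insert, Finset.mem_singleton, not_or]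
        tauto

/-- **Uniqueness of the decomposition (a.e. form).**  If bounded measurable `h_T` (`T ⊆ ι`) depend only on the
coordinates in `T`, have vanishing conditional mean in each coordinate of `T` (a.e.), and sum to zero a.e., then every
`h_T` vanishes a.e. [cite: EfronStein1981, §2 (uniqueness of the ANOVA decomposition)] -/
theorem ae_eq_zero_of_sum_parts (h : Finset ι → (ι → β) → ℝ) (hmeas : ∀ T, Measurable (h T))
    (hbdd : ∀ T, ∃ C, ∀ x, |h T x| ≤ C) (hdep : ∀ T, DependsOff (univ \ T) (h T))
    (hexact : ∀ T, ∀ i ∈ T, condAvg μ {i} (h T) =ᵐ[Measure.pi fun _ : ι => μ] 0)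
    (hsum : (fun x => ∑ T, h T x) =ᵐ[Measure.pi fun _ : ι => μ] 0) (T₀ : Finset ι) :
    h T₀ =ᵐ[Measure.pi fun _ : ι => μ] 0 := by
  set P := Measure.pi fun _ : ι => μ with hP
  -- the operator `Q g := Σ_{R ⊆ T₀} (-1)^{|R|} E_R E_{T₀ᶜ} g` isolates the part indexed by `T₀`
  let Q : ((ι → β) → ℝ) → (ι → β) → ℝ := fun g x =>
    ∑ R ∈ T₀.powerset, (-1 : ℝ) ^ R.card * condAvg μ R (condAvg μ (univ \ T₀) g) x
  -- (1) `Q` maps bounded measurable a.e.-null functions to a.e.-null functions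
  have hQnull : ∀ g : (ι → β) → ℝ, Measurable g → (∃ C, ∀ x, |g x| ≤ C) → g =ᵐ[P] 0 → Q g =ᵐ[P] 0 := by
    intro g hg hgb hg0
    obtain ⟨C, hC⟩ := hgb
    have h1 : condAvg μ (univ \ T₀) g =ᵐ[P] 0 := condAvg_ae_eq_zero _ hg hC hg0
    have h2 : ∀ R ∈ T₀.powerset, condAvg μ R (condAvg μ (univ \ T₀) g) =ᵐ[P] 0 := fun R _ =>
      condAvg_ae_eq_zero R (measurable_condAvg _ hg) (fun x => abs_condAvg_le hC x) h1
    have h3 : ∀ᵐ x ∂P, ∀ R ∈ T₀.powerset, condAvg μ R (condAvg μ (univ \ T₀) g) x = 0 :=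
      (Finset.eventually_all _).2 fun R hR => h2 R hR
    filter_upwards [h3] with x hx
    change ∑ R ∈ T₀.powerset, (-1 : ℝ) ^ R.card * condAvg μ R (condAvg μ (univ \ T₀) g) x = 0
    exact Finset.sum_eq_zero fun R hR => by rw [hx R hR, mul_zero]
  -- (2) `Q` is additive over the finite family
  have hQsum : ∀ x, Q (fun x => ∑ T, h T x) x = ∑ T, Q (h T) x := by
    intro x
    change ∑ R ∈ T₀.powerset, (-1 : ℝ) ^ R.card * condAvg μ R (condAvg μ (univ \ T₀) fun x => ∑ T, h T x) x = _
    rw [condAvg_finset_sum _ _ _ (fun T _ => hmeas T) (fun T _ => hbdd T)]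
    have : ∀ R : Finset ι, condAvg μ R (fun x => ∑ T, condAvg μ (univ \ T₀) (h T) x) x =
        ∑ T, condAvg μ R (condAvg μ (univ \ T₀) (h T)) x := fun R => by
      rw [condAvg_finset_sum _ _ _ (fun T _ => measurable_condAvg _ (hmeas T)) (fun T _ => by
        obtain ⟨C, hC⟩ := hbdd T
        exact ⟨C, fun y => abs_condAvg_le hC y⟩)]
    simp_rw [this, Finset.mul_sum]
    rw [Finset.sum_comm]
  -- (3a) `Q (h T) = 0` a.e. for `T ⊄ T₀`
  have hQoff : ∀ T, ¬ T ⊆ T₀ → Q (h T) =ᵐ[P] 0 := by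
    intro T hT
    obtain ⟨i, hiT, hiT₀⟩ := Finset.not_subset.1 hT
    obtain ⟨C, hC⟩ := hbdd T
    have hi : i ∈ univ \ T₀ := Finset.mem_sdiff.2 ⟨Finset.mem_univ _, hiT₀⟩
    have hE : condAvg μ (univ \ T₀) (h T) = condAvg μ (univ \ T₀) (condAvg μ {i} (h T)) := by
      rw [condAvg_condAvg _ _ (hmeas T) hC, Finset.union_eq_left.2 (Finset.singleton_subset_iff.2 hi)]
    have h1 : condAvg μ (univ \ T₀) (h T) =ᵐ[P] 0 := by
      rw [hE]
      exact condAvg_ae_eq_zero _ (measurable_condAvg _ (hmeas T)) (fun x => abs_condAvg_le hC x) (hexact T i hiT)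
    have h2 : ∀ R ∈ T₀.powerset, condAvg μ R (condAvg μ (univ \ T₀) (h T)) =ᵐ[P] 0 := fun R _ =>
      condAvg_ae_eq_zero R (measurable_condAvg _ (hmeas T)) (fun x => abs_condAvg_le hC x) h1
    have h3 : ∀ᵐ x ∂P, ∀ R ∈ T₀.powerset, condAvg μ R (condAvg μ (univ \ T₀) (h T)) x = 0 :=
      (Finset.eventually_all _).2 fun R hR => h2 R hR
    filter_upwards [h3] with x hx
    change ∑ R ∈ T₀.powerset, (-1 : ℝ) ^ R.card * condAvg μ R (condAvg μ (univ \ T₀) (h T)) x = 0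
    exact Finset.sum_eq_zero fun R hR => by rw [hx R hR, mul_zero]
  -- (3b) `Q (h T) = 0` pointwise for `T ⊊ T₀`
  have hQbelow : ∀ T, T ⊆ T₀ → T ≠ T₀ → ∀ x, Q (h T) x = 0 := by
    intro T hT hne x
    obtain ⟨i, hiT₀, hiT⟩ : ∃ i, i ∈ T₀ ∧ i ∉ T := Finset.exists_of_ssubset (lt_of_le_of_ne hT hne)
    obtain ⟨C, hC⟩ := hbdd T
    set g := condAvg μ (univ \ T₀) (h T) with hg
    have hgm : Measurable g := measurable_condAvg _ (hmeas T)
    have hgb : ∀ x, |g x| ≤ C := fun x => abs_condAvg_le hC x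
    have hgi : DependsOff {i} g := by
      refine dependsOff_condAvg_of_sdiff ((hdep T).mono ?_)
      intro j hj
      rw [Finset.mem_sdiff, Finset.mem_singleton] at hj
      rw [hj.1]
      exact Finset.mem_sdiff.2 ⟨Finset.mem_univ _, hiT⟩
    change ∑ R ∈ T₀.powerset, (-1 : ℝ) ^ R.card * condAvg μ R g x = 0
    refine sum_powerset_neg_one_pow_mul_eq_zero hiT₀ (fun R => condAvg μ R g x) fun R _ => ?_
    rw [Finset.insert_eq, Finset.union_comm, ← condAvg_condAvg _ _ hgm hgb, hgi.condAvg_eq]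
  -- (3c) `Q (h T₀) = h T₀` a.e.
  have hQdiag : Q (h T₀) =ᵐ[P] h T₀ := by
    obtain ⟨C, hC⟩ := hbdd T₀
    have hE : condAvg μ (univ \ T₀) (h T₀) = h T₀ := (hdep T₀).condAvg_eq
    have h2 : ∀ R ∈ T₀.powerset.erase ∅, condAvg μ R (h T₀) =ᵐ[P] 0 := by
      intro R hR
      rw [Finset.mem_erase, Finset.mem_powerset] at hR
      obtain ⟨i, hi⟩ := Finset.nonempty_iff_ne_empty.2 hR.1
      have : condAvg μ R (h T₀) = condAvg μ R (condAvg μ {i} (h T₀)) := by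
        rw [condAvg_condAvg _ _ (hmeas T₀) hC, Finset.union_eq_left.2 (Finset.singleton_subset_iff.2 hi)]
      rw [this]
      exact condAvg_ae_eq_zero R (measurable_condAvg _ (hmeas T₀)) (fun x => abs_condAvg_le hC x)
        (hexact T₀ i (hR.2 hi))
    have h3 : ∀ᵐ x ∂P, ∀ R ∈ T₀.powerset.erase ∅, condAvg μ R (h T₀) x = 0 :=
      (Finset.eventually_all _).2 fun R hR => h2 R hR
    filter_upwards [h3] with x hx
    change ∑ R ∈ T₀.powerset, (-1 : ℝ) ^ R.card * condAvg μ R (condAvg μ (univ \ T₀) (h T₀)) x = h T₀ x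
    rw [hE, ← Finset.add_sum_erase _ _ (Finset.empty_mem_powerset T₀)]
    rw [Finset.sum_eq_zero fun R hR => by rw [hx R hR, mul_zero]]
    simp
  -- assemble: `h T₀ = Q (h T₀) = Q (Σ h_T) - Σ_{T ≠ T₀} Q (h T)` a.e.
  have hall : ∀ᵐ x ∂P, ∀ T ∈ (univ : Finset (Finset ι)).erase T₀, Q (h T) x = 0 := by
    refine (Finset.eventually_all _).2 fun T hT => ?_
    rw [Finset.mem_erase] at hT
    by_cases hsub : T ⊆ T₀
    · exact Filter.Eventually.of_forall (hQbelow T hsub hT.1)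
    · exact hQoff T hsub
  have htot : Q (fun x => ∑ T, h T x) =ᵐ[P] 0 :=
    hQnull _ (Finset.measurable_sum _ fun T _ => hmeas T) (by
      choose C hC using hbdd
      exact ⟨∑ T, C T, fun x => (Finset.abs_sum_le_sum_abs _ _).trans (Finset.sum_le_sum fun T _ => hC T x)⟩) hsum
  filter_upwards [hQdiag, hall, htot] with x hx1 hx2 hx3
  rw [hQsum x, ← Finset.add_sum_erase _ _ (Finset.mem_univ T₀), Finset.sum_eq_zero hx2, add_zero] at hx3
  rw [← hx1, hx3]

end Prob

end Literature.Probability.Independence.Hoeffding
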